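import Summits.QuantumAdvantage.QuantumAdvantage.Theorems.NearExactIsExact.Negative.TwistedTranslation

/-!
# `NearExactIsExact` (stmt-QuantumAdvantage-14043) — THEOREM R1 (gen 38), part 3/4: Möbius pull-back

`moebius_pullback` (pure algebra, no degree hypotheses on the frame map): if
`c₁(u,w) ⊕ c₂(γ u, w ⊕ ℓ(u)·w₁·e₀ ⊕ B(u)) = 1_{u=0}` for all `(u,w)`, then the `s`-Möbius
coefficients `G_T(u) = Σ_{S ⊇ T} B_{S∖T}(u) · (coefC c₂ S)(γ u)` of `s ↦ c₂(γ u, B u ⊕ s)` are the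
`t`-Möbius coefficients of the pull-back `c₁ ∘ Φ`, `Φ(u,t) = (u, t ⊕ ℓ(u) t₁ e₀)`; hence
(Q1) `G_T = (c₁)_T` if `1 ∉ T ≠ ∅`, (Q2) `G_T = (c₁)_T` if `0 ∈ T` (the involution `J ↦ J ∆ {0}`),
(Q3) `G_{1ab} = (c₁)_{1ab} ⊕ ℓ · (c₁)_{0ab}` for `a, b ∉ {0,1}` (DISPROOF.md §46.9, "E-system").

HONEST FRAMING: the value here is a THEOREM (kernel-checked negative lemmas about one infinite
sub-family of the last Maiorana–McFarland habitat of `NearExactIsExact`), NOT summit progress; the crux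
and the summit are untouched.
-/

set_option linter.dupNamespace false -- D-0017: single-problem summit ⇒ `QuantumAdvantage.QuantumAdvantage` by design

namespace Summit.QuantumAdvantage.QuantumAdvantage.Theorems.NearExactIsExact.Negative.RankOneMoebius

open Finset
open Literature.Computability.QuantumComplexity
open Literature.Computability.QuantumComplexity.BuzetChailloux (bxor)
open Summit.QuantumAdvantage.QuantumAdvantage.Theorems.NearExactIsExact.Negative.SkewProductCore
open Summit.QuantumAdvantage.QuantumAdvantage.Theorems.NearExactIsExact.Negative.SkewProductResidual
open Summit.QuantumAdvantage.QuantumAdvantage.Theorems.NearExactIsExact.Negative.TwistedTranslation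

open scoped symmDiff in
/-- **THEOREM R1, Möbius pull-back (Q1)–(Q3).** See the module docstring. [folklore] -/
theorem moebius_pullback (γ : (Fin 6 → Bool) → (Fin 6 → Bool))
    (B : Fin 5 → (Fin 6 → Bool) → Bool) (ℓ : (Fin 6 → Bool) → Bool)
    (c₁ c₂ : (Fin (6 + 5) → Bool) → Bool) (h₁ : IsDegLeFun 3 c₁) (h₂ : IsDegLeFun 3 c₂)
    (h : ∀ (u : Fin 6 → Bool) (w : Fin 5 → Bool),
      (c₁ (Fin.append u w) ^^
        c₂ (Fin.append (γ u) (fun k => (w k ^^ (decide (k = 0) && (ℓ u && w 1))) ^^ B k u))) =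
        decide (∀ i, u i = false)) :
    (∀ T : Finset (Fin 5), (1 : Fin 5) ∉ T → T.Nonempty → ∀ u,
      decide ((∑ S ∈ (P3 5).filter (fun S => T ⊆ S),
        (∏ m ∈ S \ T, ind (B m u)) * ind (coefC c₂ S (γ u))) = 1) = coefC c₁ T u) ∧
    (∀ T : Finset (Fin 5), (0 : Fin 5) ∈ T → ∀ u,
      decide ((∑ S ∈ (P3 5).filter (fun S => T ⊆ S),
        (∏ m ∈ S \ T, ind (B m u)) * ind (coefC c₂ S (γ u))) = 1) = coefC c₁ T u) ∧
    (∀ a b : Fin 5, a ≠ 0 → a ≠ 1 → b ≠ 0 → b ≠ 1 → a ≠ b → ∀ u,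
      decide ((∑ S ∈ (P3 5).filter (fun S => ({1, a, b} : Finset (Fin 5)) ⊆ S),
        (∏ m ∈ S \ {1, a, b}, ind (B m u)) * ind (coefC c₂ S (γ u))) = 1) =
        (coefC c₁ {1, a, b} u ^^ (ℓ u && coefC c₁ {0, a, b} u))) := by
  have z2 : (2 : ZMod 2) = 0 := rfl
  -- the transvection `tw u` of the block and the pull-back `c₁' = c₁ ∘ Φ`
  obtain ⟨tw, htw⟩ : ∃ tw : (Fin 6 → Bool) → (Fin 5 → Bool) → Fin 5 → Bool,
      tw = fun u w k => (w k ^^ (decide (k = 0) && (ℓ u && w 1))) := ⟨_, rfl⟩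
  have hinv : ∀ u w k, tw u (tw u w) k = w k := by
    intro u w k
    rw [htw]
    dsimp only
    have e : decide ((1 : Fin 5) = 0) = false := by decide
    rw [e, Bool.false_and, Bool.xor_false]
    generalize (decide (k = 0) && (ℓ u && w 1)) = x
    cases w k <;> cases x <;> rfl
  have htw_of : ∀ u w, w 1 = false → tw u w = w := by
    intro u w hw; funext k; rw [htw]; simp [hw]
  obtain ⟨c₁', hc₁'⟩ : ∃ c₁' : (Fin (6 + 5) → Bool) → Bool,
      c₁' = fun x => c₁ (Fin.append (uPart x) (tw (uPart x) (tPart x))) := ⟨_, rfl⟩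
  have happ : ∀ u w, c₁' (Fin.append u w) = c₁ (Fin.append u (tw u w)) := by
    intro u w
    have hu : uPart (Fin.append u w) = u := funext fun i => Fin.append_left u w i
    have ht : tPart (Fin.append u w) = w := funext fun k => Fin.append_right u w k
    rw [hc₁']
    dsimp only
    rw [hu, ht]
  -- (x) the residual equation solved for `c₂`, in the coordinates `s = tw u t`
  have hx : ∀ (u : Fin 6 → Bool) (s : Fin 5 → Bool),
      c₂ (Fin.append (γ u) (fun k => s k ^^ B k u)) =
        (c₁' (Fin.append u s) ^^ decide (∀ i, u i = false)) := by
    intro u s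
    have h' := h u (tw u s)
    have e : ∀ k, (tw u s k ^^ (decide (k = 0) && (ℓ u && tw u s 1))) = s k := by
      intro k
      have := hinv u s k
      rw [htw] at this ⊢
      exact this
    simp only [e] at h'
    rw [happ]
    exact bool_solve _ _ _ h'
  -- the `s`-Möbius coefficients `G_T(u)` of `s ↦ c₂(γ u, B u ⊕ s)`
  obtain ⟨G, hGdef⟩ : ∃ G : Finset (Fin 5) → (Fin 6 → Bool) → ZMod 2, ∀ T u, G T u =
      ∑ S ∈ (P3 5).filter (fun S => T ⊆ S),
        (∏ m ∈ S \ T, ind (B m u)) * ind (coefC c₂ S (γ u)) := ⟨fun T u => _, fun _ _ => rfl⟩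
  simp only [← hGdef]
  -- (G) `G_T(u) = Σ_{J ⊆ T} c₁'(u, 1_J)` for `T ≠ ∅`
  have hG : ∀ T : Finset (Fin 5), T.Nonempty → ∀ u,
      G T u = ∑ J ∈ T.powerset, ind (c₁' (bxor (emb 5 u) (L J))) := by
    intro T hT u
    rw [hGdef, tTcoef_eq B (fun S u => coefC c₂ S (γ u)) T u]
    have hJ : ∀ J ∈ T.powerset, texp (fun S u => coefC c₂ S (γ u)) (fun m => decide (m ∈ J) ^^ B m u) u =
        ind (c₁' (bxor (emb 5 u) (L J))) + ind (decide (∀ i, u i = false)) := by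
      intro J _
      rw [← expand_comp c₂ h₂, emb_bxor_L, ← ind_xor, ← hx u (indic J)]
      rfl
    have h2T : ((2 ^ T.card : ℕ) : ZMod 2) = 0 := by
      rw [Nat.cast_pow, Nat.cast_ofNat, z2]
      exact zero_pow (card_pos.mpr hT).ne'
    rw [sum_congr rfl hJ, sum_add_distrib, sum_const, card_powerset, nsmul_eq_mul, h2T, zero_mul,
      add_zero]
  -- (Q1) `1 ∉ T`: `Φ` fixes the points `(u, 1_J)`, `J ⊆ T`
  have hQ1 : ∀ T : Finset (Fin 5), (1 : Fin 5) ∉ T → ∀ u, ∀ J ∈ T.powerset,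
      c₁' (bxor (emb 5 u) (L J)) = c₁ (bxor (emb 5 u) (L J)) := by
    intro T h1 u J hJ
    have h1J : indic J 1 = false := decide_eq_false fun h => h1 (mem_powerset.mp hJ h)
    rw [emb_bxor_L, happ, htw_of u (indic J) h1J]
  have hQ1c : ∀ T : Finset (Fin 5), (1 : Fin 5) ∉ T → T.Nonempty → ∀ u,
      decide (G T u = 1) = coefC c₁ T u := by
    intro T h1 hT u
    rw [hG T hT u, sum_congr rfl (fun J hJ => by rw [hQ1 T h1 u J hJ])]
    rfl
  -- (Q2) `0 ∈ T`: the involution `J ↦ J ∆ {0}` of `T.powerset`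
  have hQ2c : ∀ T : Finset (Fin 5), (0 : Fin 5) ∈ T → ∀ u, decide (G T u = 1) = coefC c₁ T u := by
    intro T h0 u
    rw [hG T ⟨0, h0⟩ u]
    have hs : ∑ J ∈ T.powerset,
        (ind (c₁' (bxor (emb 5 u) (L J))) + ind (c₁ (bxor (emb 5 u) (L J)))) = 0 := by
      have hval : ∀ J : Finset (Fin 5),
          (c₁' (bxor (emb 5 u) (L J)) ^^ c₁ (bxor (emb 5 u) (L J))) =
            (c₁' (bxor (emb 5 u) (L (J ∆ {0}))) ^^ c₁ (bxor (emb 5 u) (L (J ∆ {0})))) := by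
        intro J
        have hflip : ∀ K : Finset (Fin 5), (ℓ u && decide ((1 : Fin 5) ∈ K)) = true →
            tw u (indic K) = indic (K ∆ {0}) := by
          intro K hK
          funext k
          rw [htw]
          simp only [indic]
          rw [Bool.and_eq_true] at hK
          rw [hK.1, hK.2]
          by_cases hk : k = 0
          · subst hk; simp [mem_symmDiff]
          · simp [mem_symmDiff, hk]
        have hmem1 : decide ((1 : Fin 5) ∈ J ∆ {0}) = decide ((1 : Fin 5) ∈ J) := by
          simp [mem_symmDiff]
        rw [emb_bxor_L, emb_bxor_L, happ, happ]
        cases hc : (ℓ u && decide ((1 : Fin 5) ∈ J))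
        · -- `Φ` fixes both points
          have hc' : (ℓ u && decide ((1 : Fin 5) ∈ J ∆ {0})) = false := by rw [hmem1]; exact hc
          have t1 : tw u (indic J) = indic J := by
            funext k; rw [htw]; dsimp only; simp only [indic] at hc ⊢; rw [hc]; simp
          have t2 : tw u (indic (J ∆ {0})) = indic (J ∆ {0}) := by
            funext k; rw [htw]; dsimp only; simp only [indic] at hc' ⊢; rw [hc']; simp
          rw [t1, t2, Bool.xor_self, Bool.xor_self]
        · have hc' : (ℓ u && decide ((1 : Fin 5) ∈ J ∆ {0})) = true := by rw [hmem1]; exact hc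
          rw [hflip J hc, hflip (J ∆ {0}) hc', symmDiff_symmDiff_cancel_right, Bool.xor_comm]
      refine sum_involution (fun J _ => J ∆ {0}) (fun J _ => ?_) (fun J _ _ => ?_) (fun J hJ => ?_)
        (fun J _ => symmDiff_symmDiff_cancel_right _ _)
      · rw [← ind_xor, ← ind_xor, hval J, CharTwo.add_self_eq_zero]
      · intro hJ
        have h0 : (0 : Fin 5) ∈ J ∆ {0} ↔ (0 : Fin 5) ∉ J := by simp [mem_symmDiff]
        rw [hJ] at h0
        exact iff_not_self h0
      · rw [mem_powerset] at hJ ⊢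
        intro k hk
        rw [mem_symmDiff] at hk
        rcases hk with ⟨hkJ, -⟩ | ⟨hk0, -⟩
        · exact hJ hkJ
        · rw [mem_singleton] at hk0; rw [hk0]; exact h0
    rw [sum_add_distrib] at hs
    have e : ∑ J ∈ T.powerset, ind (c₁' (bxor (emb 5 u) (L J))) =
        ∑ J ∈ T.powerset, ind (c₁ (bxor (emb 5 u) (L J))) := by
      linear_combination hs - (∑ J ∈ T.powerset, ind (c₁ (bxor (emb 5 u) (L J)))) * z2
    rw [e]
    rfl
  -- (Q3) `T = {1, a, b}`, `a, b ≥ 2`: `G_{1ab} = (c₁)_{1ab} ⊕ ℓ·(c₁)_{0ab}`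
  have hQ3c : ∀ a b : Fin 5, a ≠ 0 → a ≠ 1 → b ≠ 0 → b ≠ 1 → a ≠ b → ∀ u,
      decide (G {1, a, b} u = 1) = (coefC c₁ {1, a, b} u ^^ (ℓ u && coefC c₁ {0, a, b} u)) := by
    intro a b ha0 ha1 hb0 hb1 hab u
    have h1ab : (1 : Fin 5) ∉ ({a, b} : Finset (Fin 5)) := by
      simp only [mem_insert, mem_singleton, not_or]; exact ⟨fun h => ha1 h.symm, fun h => hb1 h.symm⟩
    have h0ab : (0 : Fin 5) ∉ ({a, b} : Finset (Fin 5)) := by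
      simp only [mem_insert, mem_singleton, not_or]; exact ⟨fun h => ha0 h.symm, fun h => hb0 h.symm⟩
    have h1_0ab : (1 : Fin 5) ∉ ({0, a, b} : Finset (Fin 5)) := by
      simp only [mem_insert, mem_singleton, not_or]
      exact ⟨by decide, fun h => ha1 h.symm, fun h => hb1 h.symm⟩
    rw [hG _ ⟨1, mem_insert_self _ _⟩ u, sum_powerset_insert h1ab]
    have hA : ∀ J ∈ ({a, b} : Finset (Fin 5)).powerset,
        ind (c₁' (bxor (emb 5 u) (L J))) = ind (c₁ (bxor (emb 5 u) (L J))) := fun J hJ => by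
      rw [hQ1 {a, b} h1ab u J hJ]
    rw [sum_congr rfl hA]
    have eR : coefC c₁ {1, a, b} u = decide ((∑ J ∈ ({a, b} : Finset (Fin 5)).powerset,
        ind (c₁ (bxor (emb 5 u) (L J))) + ∑ J ∈ ({a, b} : Finset (Fin 5)).powerset,
        ind (c₁ (bxor (emb 5 u) (L (insert 1 J))))) = 1) := by
      show decide ((∑ J ∈ (insert (1 : Fin 5) ({a, b} : Finset (Fin 5))).powerset,
        ind (c₁ (bxor (emb 5 u) (L J)))) = 1) = _
      rw [sum_powerset_insert h1ab]
    rw [eR]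
    cases hl : ℓ u
    · -- `ℓ u = 0`: `Φ` fixes every point over `u`
      have hB' : ∀ J ∈ ({a, b} : Finset (Fin 5)).powerset,
          ind (c₁' (bxor (emb 5 u) (L (insert 1 J)))) = ind (c₁ (bxor (emb 5 u) (L (insert 1 J)))) := by
        intro J _
        rw [emb_bxor_L, happ]
        have e : tw u (indic (insert 1 J)) = indic (insert 1 J) := by
          funext k; rw [htw]; simp [hl]
        rw [e]
      rw [sum_congr rfl hB', Bool.false_and, Bool.xor_false]
    · -- `ℓ u = 1`: `Φ(u, 1_{J ∪ 1}) = (u, 1_{J ∪ {0,1}})`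
      have hB' : ∀ J ∈ ({a, b} : Finset (Fin 5)).powerset,
          ind (c₁' (bxor (emb 5 u) (L (insert 1 J)))) =
            ind (c₁ (bxor (bxor (emb 5 u) (dir 1)) (L (insert 0 J)))) := by
        intro J hJ
        have h0J : (0 : Fin 5) ∉ J := fun h => h0ab (mem_powerset.mp hJ h)
        have h1J : (1 : Fin 5) ∉ J := fun h => h1ab (mem_powerset.mp hJ h)
        have h01J : (0 : Fin 5) ∉ insert 1 J := by
          rw [mem_insert, not_or]; exact ⟨by decide, h0J⟩
        rw [emb_bxor_L, happ]
        have htwK : tw u (indic (insert 1 J)) = indic (insert 0 (insert 1 J)) := by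
          funext k
          rw [htw]
          simp only [indic]
          rw [hl, decide_eq_true (mem_insert_self (1 : Fin 5) J), Bool.true_and, Bool.and_true]
          by_cases hk : k = 0
          · subst hk
            rw [decide_eq_false h01J, decide_eq_true rfl, decide_eq_true (mem_insert_self _ _)]
            rfl
          · rw [decide_eq_false hk, Bool.xor_false]
            have : k ∈ insert 0 (insert 1 J) ↔ k ∈ insert 1 J := by
              rw [mem_insert (a := k) (b := 0)]; exact ⟨fun h => h.resolve_left hk, Or.inr⟩
            exact decide_eq_decide.mpr this.symm
        rw [htwK, ← emb_bxor_L, L_insert h01J, L_insert h1J, L_insert h0J]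
        congr 2
        funext j
        simp only [bxor]
        generalize emb 5 u j = p
        generalize L J j = q
        cases p <;> cases q <;> cases dir (1 : Fin 5) j <;> cases dir (0 : Fin 5) j <;> rfl
      have hK : dsum c₁ {0, a, b} (bxor (emb 5 u) (dir 1)) = coefC c₁ {0, a, b} u := by
        have e := congrFun (dsum_insert c₁ h1_0ab) (emb 5 u)
        have h4 : 3 < (insert (1 : Fin 5) ({0, a, b} : Finset (Fin 5))).card := by
          rw [card_insert_of_notMem h1_0ab, card_insert_of_notMem h0ab, card_pair hab]; norm_num
        rw [dsum_eq_false c₁ h₁ h4 (emb 5 u)] at e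
        show dsum c₁ {0, a, b} (bxor (emb 5 u) (dir 1)) = dsum c₁ {0, a, b} (emb 5 u)
        revert e
        generalize dsum c₁ {0, a, b} (bxor (emb 5 u) (dir 1)) = p
        generalize dsum c₁ {0, a, b} (emb 5 u) = q
        cases p <;> cases q <;> simp
      have hBsum : ∑ J ∈ ({a, b} : Finset (Fin 5)).powerset,
          ind (c₁ (bxor (bxor (emb 5 u) (dir 1)) (L (insert 0 J)))) =
          ind (coefC c₁ {0, a, b} u) +
            ∑ J ∈ ({a, b} : Finset (Fin 5)).powerset, ind (c₁ (bxor (emb 5 u) (L (insert 1 J)))) := by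
        rw [← hK]
        simp only [dsum, ind_decide_eq_one]
        rw [sum_powerset_insert h0ab]
        have e2 : ∀ J ∈ ({a, b} : Finset (Fin 5)).powerset,
            ind (c₁ (bxor (bxor (emb 5 u) (dir 1)) (L J))) = ind (c₁ (bxor (emb 5 u) (L (insert 1 J)))) := by
          intro J hJ
          have h1J : (1 : Fin 5) ∉ J := fun h => h1ab (mem_powerset.mp hJ h)
          rw [L_insert h1J, SignedExactCubicForrelationNotPrBPP.PolarGeometry.bxor_bxor_swap]
        rw [sum_congr rfl e2]
        linear_combination (-(∑ J ∈ ({a, b} : Finset (Fin 5)).powerset,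
          ind (c₁ (bxor (emb 5 u) (L (insert 1 J)))))) * z2
      rw [sum_congr rfl hB', hBsum]
      simp only [zmod2_decide_add, decide_ind_eq_one, Bool.true_and]
      generalize decide ((∑ J ∈ ({a, b} : Finset (Fin 5)).powerset, ind (c₁ (bxor (emb 5 u) (L J)))) = 1) = p
      generalize decide ((∑ J ∈ ({a, b} : Finset (Fin 5)).powerset,
        ind (c₁ (bxor (emb 5 u) (L (insert 1 J))))) = 1) = q
      generalize coefC c₁ {0, a, b} u = w
      cases p <;> cases q <;> cases w <;> rfl
  exact ⟨hQ1c, hQ2c, hQ3c⟩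

end Summit.QuantumAdvantage.QuantumAdvantage.Theorems.NearExactIsExact.Negative.RankOneMoebius
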